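import Mathlib
import HarnessLib
import Summits.CriticalPhenomena.PercolationContinuityZ3.Theses.PercLowPointHalfSpace
import Literature.Probability.Percolation.HalfSpaceFloorDilution
import Literature.Probability.Percolation.UniversalTightness
import Literature.Probability.LatticeModels.ProdBernoulliIndependence
import Literature.Probability.Percolation.BondPercolationSymmetry
import Literature.Probability.LatticeModels.ProdBernoulliClusterLocality

/-!
# Dilution toolkit: stub `stub_dilutionToolkit` of line SketchIdeator1 (skeleton floor-russo), crux LowPointBookkeeping

Helper file for the crux skeleton `Cruxes/LowPointBookkeeping/Lines/SketchIdeator1.lean`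
(item `stmt-CriticalPhenomena-14713`,
`Summit.CriticalPhenomena.PercolationContinuityZ3.Theses.PercLowPointHalfSpace.LowPointBookkeeping`).
Proves EXACTLY the registered stub signature `stub_dilutionToolkit`; no new definition.

## The statement

Write `ℍ = {x ∈ ℤ³ | 0 ≤ x₀}`, `p_c = p_c(ℤ³)` and `P_s = floorDilutedPercolation 3 p_c s`
(the floor-diluted critical half-space measure, a product Bernoulli measure
`prodBernoulli (floorDilutedParam 3 p_c s)` with weights `s p_c` on the floor edges, `p_c` on the
other edges of `ℍ`, `0` on the edges leaving `ℍ`).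

* (i) **Horizontal translation invariance**: for a floor vector `z` (`z₀ = 0`) the configuration
  shift `ω ↦ ω + z` preserves `P_s`.
* (ii) **Exponential tail of the local mass of `C_ℍ(x)`**: if for the half-boxes
  `Λ = (x + B_n) ∩ ℍ` (`x = 0` or one of the four floor neighbours of `0`) the maximal cluster
  trace satisfies `P_1(|K_max(Λ)| ≥ C n^{11/4}) ≤ e^{-1}`, then for all `s`, `t ≥ 1`,
  `P_s(#{y ∈ B_n | x ↔_ℍ x + y} ≥ t (C+1) n^{11/4}) ≤ e^{3/2} e^{-t/2}`.

## Proof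

(i) The shift by `z` is a graph automorphism of `ℤ³` (`zdGraph_adj_shift_iff`) fixing the
functional `x ↦ x₀`, hence it maps floor edges to floor edges and half-space edges to half-space
edges, so the weights `floorDilutedParam` are invariant under `sym2Equiv (Site.shift z)`;
`prodBernoulli_map_image_equiv` (invariance of a product Bernoulli measure under a
weight-preserving bijection of the index set) concludes.

(ii) With `M = typicalMax P_1 Λ` (Hutchcroft's typical value), the hypothesis and the definition
of `M` as an infimum give `M ≤ ⌈C n^{11/4}⌉ ≤ (C+1) n^{11/4} =: T`. Hutchcroft's universal
tightness (`prodBernoulli_real_clusterCapIn_ge_le_exp_mul`) with `α = tT/M ≥ t ≥ 1` gives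
`P_1(|K_x ∩ Λ| ≥ tT) ≤ exp((3-α)/2) ≤ e^{3/2} e^{-t/2}`. Pointwise
`#{y ∈ B_n | x ↔_ℍ x + y} ≤ |K_x ∩ Λ|` (`y ↦ x + y` is injective, an `ℍ`-open path is an open
path), and `{|K_x ∩ Λ| ≥ ⌈tT⌉}` is increasing and measurable, so
`P_s(mass ≥ tT) ≤ P_s(|K_x ∩ Λ| ≥ ⌈tT⌉) ≤ P_1(|K_x ∩ Λ| ≥ ⌈tT⌉)` by the monotone coupling in the
floor density (`floorDilutedPercolation_mono_of_isUpperSet`, `s ≤ 1`).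
-/

noncomputable section

namespace Summit.CriticalPhenomena.PercolationContinuityZ3.Theorems.FloorRusso

open MeasureTheory Filter Topology
open Literature.Probability.Percolation Literature.Probability.LatticeModels
open scoped ENNReal

namespace DilutionToolkit

/-! ### (i) Horizontal shifts preserve the floor-diluted weights -/

/-- A translation of `ℤ³` maps lattice edges to lattice edges. -/
theorem shift_mem_edgeSet_iff (z : Site 3) (e : Sym2 (Site 3)) :
    sym2Equiv (Site.shift z) e ∈ (zdGraph 3).edgeSet ↔ e ∈ (zdGraph 3).edgeSet :=
  sym2Equiv_mem_edgeSet_iff (G := zdGraph 3) (G' := zdGraph 3)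
    { toEquiv := Site.shift z, map_rel_iff' := fun {a b} => zdGraph_adj_shift_iff z a b } e

/-- A horizontal translation (`z 0 = 0`) maps floor edges to floor edges. -/
theorem shift_mem_floorEdgeSet_iff (z : Site 3) (hz : z 0 = 0) (e : Sym2 (Site 3)) :
    sym2Equiv (Site.shift z) e ∈ floorEdgeSet 3 ↔ e ∈ floorEdgeSet 3 := by
  rw [mem_floorEdgeSet_iff, mem_floorEdgeSet_iff, shift_mem_edgeSet_iff]
  refine and_congr_right fun _ => ?_
  simp only [sym2Equiv_apply, Sym2.mem_map, Site.shift_apply]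
  constructor
  · intro h w hw
    have := h (w + z) ⟨w, hw, rfl⟩
    simpa [hz] using this
  · rintro h _ ⟨w, hw, rfl⟩
    simp [hz, h w hw]

/-- A horizontal translation (`z 0 = 0`) maps half-space edges to half-space edges. -/
theorem shift_mem_halfSpaceEdgeSet_iff (z : Site 3) (hz : z 0 = 0) (e : Sym2 (Site 3)) :
    sym2Equiv (Site.shift z) e ∈ halfSpaceEdgeSet 3 ↔ e ∈ halfSpaceEdgeSet 3 := by
  rw [mem_halfSpaceEdgeSet_iff, mem_halfSpaceEdgeSet_iff, shift_mem_edgeSet_iff]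
  refine and_congr_right fun _ => ?_
  simp only [sym2Equiv_apply, Sym2.mem_map, Site.shift_apply]
  constructor
  · intro h w hw
    have := h (w + z) ⟨w, hw, rfl⟩
    simpa [hz] using this
  · rintro h _ ⟨w, hw, rfl⟩
    simp [hz, h w hw]

/-- The floor-diluted weights are invariant under horizontal translations. -/
theorem floorDilutedParam_shift (p s : unitInterval) (z : Site 3) (hz : z 0 = 0)
    (e : Sym2 (Site 3)) :
    floorDilutedParam 3 p s (sym2Equiv (Site.shift z) e) = floorDilutedParam 3 p s e := by
  by_cases hf : e ∈ floorEdgeSet 3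
  · rw [floorDilutedParam_of_mem_floorEdgeSet p s hf,
      floorDilutedParam_of_mem_floorEdgeSet p s ((shift_mem_floorEdgeSet_iff z hz e).2 hf)]
  · have hf' : sym2Equiv (Site.shift z) e ∉ floorEdgeSet 3 :=
      fun h => hf ((shift_mem_floorEdgeSet_iff z hz e).1 h)
    by_cases hh : e ∈ halfSpaceEdgeSet 3
    · rw [floorDilutedParam_of_not_mem_floorEdgeSet p s hh hf,
        floorDilutedParam_of_not_mem_floorEdgeSet p s
          ((shift_mem_halfSpaceEdgeSet_iff z hz e).2 hh) hf']
    · rw [floorDilutedParam_of_not_mem_halfSpaceEdgeSet p s hh,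
        floorDilutedParam_of_not_mem_halfSpaceEdgeSet p s
          fun h => hh ((shift_mem_halfSpaceEdgeSet_iff z hz e).1 h)]

/-- **(i) Horizontal translation invariance of `P^{ℍ}_{p_c,s}`**: for `z 0 = 0` the configuration
shift `ω ↦ ω + z` preserves the floor-diluted critical half-space measure. -/
theorem map_shift (s : unitInterval) (z : Site 3) (hz : z 0 = 0) :
    (floorDilutedPercolation 3 (criticalProbI 3) s).map
        (BondConfig.relabel (sym2Equiv (Site.shift z))) =
      floorDilutedPercolation 3 (criticalProbI 3) s :=
  prodBernoulli_map_image_equiv (floorDilutedParam 3 (criticalProbI 3) s)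
    (sym2Equiv (Site.shift z)) (floorDilutedParam_shift _ s z hz)

/-! ### (ii) Exponential tail of the local half-space cluster mass -/

/-- Pointwise comparison: the number of `y ∈ B_n` with `x ↔_ℍ x + y` is at most `|K_x ∩ Λ|`
for the half-box `Λ = (x + B_n) ∩ ℍ` (`y ↦ x + y` is injective and an `ℍ`-open path is open). -/
theorem ncard_le_clusterCapIn (x : Site 3) (n : ℕ) (ω : BondConfig (Site 3)) :
    ((↑(box 3 n) : Set (Site 3)) ∩
        {y : Site 3 | ω ∈ openConnIn {x : Site 3 | 0 ≤ x 0} x (x + y)}).ncard ≤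
      clusterCapIn (((box 3 n).image fun y : Site 3 => x + y).filter fun z : Site 3 => 0 ≤ z 0)
        ω x := by
  rw [clusterCapIn_eq, ← Set.ncard_coe_finset]
  refine Set.ncard_le_ncard_of_injOn (fun y => x + y) ?_ (add_right_injective x).injOn
    (Finset.finite_toSet _)
  rintro y ⟨hyb, _, hyH, hr⟩
  simp only [Finset.mem_coe, Finset.mem_filter, Finset.mem_image]
  exact ⟨⟨⟨y, hyb, rfl⟩, hyH⟩, hr.map (SimpleGraph.Embedding.induce _).toHom⟩

/-- **(ii) Exponential tail of the mass of `C_ℍ(x)` in `x + B_n`** from the no-fat-half-box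
hypothesis at `s = 1`, via Hutchcroft's universal tightness and the monotone coupling in `s`. -/
theorem tail (C : ℝ) (hC : 0 < C)
    (hfat : ∀ x ∈ insert (0 : Site 3)
        ({Pi.single 1 1, Pi.single 1 (-1), Pi.single 2 1, Pi.single 2 (-1)} : Finset (Site 3)),
      ∀ n : ℕ, 1 ≤ n →
        (floorDilutedPercolation 3 (criticalProbI 3) 1).real
          {ω | C * (n : ℝ) ^ ((11 : ℝ) / 4) ≤
            (clusterMaxIn (((box 3 n).image fun y : Site 3 => x + y).filter
              fun z : Site 3 => 0 ≤ z 0) ω : ℝ)} ≤ Real.exp (-1))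
    (s : unitInterval) (x : Site 3)
    (hx : x ∈ insert (0 : Site 3)
      ({Pi.single 1 1, Pi.single 1 (-1), Pi.single 2 1, Pi.single 2 (-1)} : Finset (Site 3)))
    (n : ℕ) (hn : 1 ≤ n) (t : ℝ) (ht : 1 ≤ t) :
    (floorDilutedPercolation 3 (criticalProbI 3) s).real
        {ω | t * ((C + 1) * (n : ℝ) ^ ((11 : ℝ) / 4)) ≤
          (((↑(box 3 (n)) : Set (Site 3)) ∩
            {y : Site 3 | ω ∈ openConnIn {x : Site 3 | 0 ≤ x 0} x (x + y)}).ncard : ℝ)} ≤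
      Real.exp (3 / 2) * Real.exp (-t / 2) := by
  -- the base point lies on the floor
  have hx0 : x 0 = 0 := by
    simp only [Finset.mem_insert, Finset.mem_singleton] at hx
    rcases hx with rfl | rfl | rfl | rfl | rfl <;> simp
  -- the half-box, the undiluted measure and its typical maximal cluster size
  obtain ⟨Λ, hΛdef⟩ : ∃ Λ : Finset (Site 3),
      Λ = ((box 3 n).image fun y : Site 3 => x + y).filter fun z : Site 3 => 0 ≤ z 0 := ⟨_, rfl⟩
  have hxΛ : x ∈ Λ := by
    rw [hΛdef]
    exact Finset.mem_filter.2 ⟨Finset.mem_image.2 ⟨0, zero_mem_box 3 n, add_zero x⟩, hx0.ge⟩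
  have hΛ : Λ.Nonempty := ⟨x, hxΛ⟩
  obtain ⟨μ, hμdef⟩ : ∃ μ : Measure (BondConfig (Site 3)),
      μ = prodBernoulli (floorDilutedParam 3 (criticalProbI 3) 1) := ⟨_, rfl⟩
  have hμ1 : floorDilutedPercolation 3 (criticalProbI 3) 1 = μ := hμdef.symm
  haveI : IsProbabilityMeasure μ := by rw [hμdef]; infer_instance
  obtain ⟨M, hMdef⟩ : ∃ M : ℕ, M = typicalMax μ Λ := ⟨_, rfl⟩
  obtain ⟨T, hTdef⟩ : ∃ T : ℝ, T = (C + 1) * (n : ℝ) ^ ((11 : ℝ) / 4) := ⟨_, rfl⟩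
  have hr1 : (1 : ℝ) ≤ (n : ℝ) ^ ((11 : ℝ) / 4) :=
    Real.one_le_rpow (by exact_mod_cast hn) (by norm_num)
  have hCr : 0 ≤ C * (n : ℝ) ^ ((11 : ℝ) / 4) := mul_nonneg hC.le (by linarith)
  -- Step 1: `M ≤ T` from the hypothesis and the definition of the typical value as an infimum
  have hMT : (M : ℝ) ≤ T := by
    have hk : μ.real {ω | ⌈C * (n : ℝ) ^ ((11 : ℝ) / 4)⌉₊ ≤ clusterMaxIn Λ ω} ≤ Real.exp (-1) := by
      refine le_trans (measureReal_mono (fun ω hω => ?_) (measure_ne_top _ _))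
        (hμ1 ▸ hΛdef ▸ hfat x hx n hn)
      simp only [Set.mem_setOf_eq] at hω ⊢
      exact le_trans (Nat.le_ceil _) (by exact_mod_cast hω)
    have hMk : M ≤ ⌈C * (n : ℝ) ^ ((11 : ℝ) / 4)⌉₊ := hMdef ▸ Nat.sInf_le hk
    have hMk' : (M : ℝ) ≤ ⌈C * (n : ℝ) ^ ((11 : ℝ) / 4)⌉₊ := by exact_mod_cast hMk
    have hk2 := Nat.ceil_lt_add_one hCr
    rw [hTdef]
    nlinarith
  have hM2 : 2 ≤ M := hMdef ▸ two_le_typicalMax μ hΛ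
  have hMpos : (0 : ℝ) < M := by exact_mod_cast lt_of_lt_of_le (by norm_num) hM2
  -- Step 2: universal tightness at level `α M = t T`
  obtain ⟨α, hαdef⟩ : ∃ α : ℝ, α = t * T / M := ⟨_, rfl⟩
  have hTM : 1 ≤ T / M := (one_le_div hMpos).2 hMT
  have ht0 : 0 ≤ t := le_trans zero_le_one ht
  have htα : t ≤ α := by rw [hαdef, mul_div_assoc]; exact le_mul_of_one_le_right ht0 hTM
  have hα : 1 ≤ α := le_trans ht htα
  have hαM : α * M = t * T := by rw [hαdef]; exact div_mul_cancel₀ _ hMpos.ne'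
  have key := prodBernoulli_real_clusterCapIn_ge_le_exp_mul
    (floorDilutedParam 3 (criticalProbI 3) 1) hΛ x hα
  rw [← hμdef, ← hMdef] at key
  -- Step 3: event inclusions and the monotone coupling in the floor density
  have h1 : (floorDilutedPercolation 3 (criticalProbI 3) s).real
        {ω | t * ((C + 1) * (n : ℝ) ^ ((11 : ℝ) / 4)) ≤
          (((↑(box 3 (n)) : Set (Site 3)) ∩
            {y : Site 3 | ω ∈ openConnIn {x : Site 3 | 0 ≤ x 0} x (x + y)}).ncard : ℝ)} ≤
      (floorDilutedPercolation 3 (criticalProbI 3) s).real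
        {ω | ⌈t * T⌉₊ ≤ clusterCapIn Λ ω x} := by
    refine measureReal_mono (fun ω hω => ?_) (measure_ne_top _ _)
    simp only [Set.mem_setOf_eq] at hω ⊢
    refine Nat.ceil_le.2 (le_trans ?_ (le_trans hω ?_))
    · rw [hTdef]
    · rw [hΛdef]; exact_mod_cast ncard_le_clusterCapIn x n ω
  have h2 : (floorDilutedPercolation 3 (criticalProbI 3) s).real
        {ω | ⌈t * T⌉₊ ≤ clusterCapIn Λ ω x} ≤ μ.real {ω | ⌈t * T⌉₊ ≤ clusterCapIn Λ ω x} := by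
    rw [← hμ1]
    simp only [measureReal_def]
    exact ENNReal.toReal_mono (measure_ne_top _ _)
      (floorDilutedPercolation_mono_of_isUpperSet (criticalProbI 3) unitInterval.le_one'
        (isUpperSet_clusterCapIn_ge Λ x _) (measurableSet_clusterCapIn_ge Λ x _))
  have h3 : μ.real {ω | ⌈t * T⌉₊ ≤ clusterCapIn Λ ω x} ≤
      μ.real {ω | α * M ≤ (clusterCapIn Λ ω x : ℝ)} := by
    refine measureReal_mono (fun ω hω => ?_) (measure_ne_top _ _)
    simp only [Set.mem_setOf_eq] at hω ⊢
    rw [hαM]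
    exact le_trans (Nat.le_ceil _) (by exact_mod_cast hω)
  have h4 : μ.real {ω | α * M ≤ (clusterCapIn Λ ω x : ℝ)} ≤ Real.exp ((3 - α) / 2) := by
    refine le_trans key ?_
    refine le_trans (mul_le_mul_of_nonneg_left measureReal_le_one (Real.exp_pos _).le) ?_
    rw [mul_one]
  have h5 : Real.exp ((3 - α) / 2) ≤ Real.exp (3 / 2) * Real.exp (-t / 2) := by
    rw [← Real.exp_add]
    exact Real.exp_le_exp.2 (by linarith)
  exact h1.trans (h2.trans (h3.trans (h4.trans h5)))

end DilutionToolkit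

/-- **stub_dilutionToolkit**: (i) horizontal translation invariance of `P^{ℍ}_{p_c,s}`
(shifts by floor vectors preserve the floor-diluted weights, `prodBernoulli_map_image_equiv`);
(ii) the exponential tail `P_s(#{y ∈ B_n | x ↔_ℍ x + y} ≥ t (C+1) n^{11/4}) ≤ e^{3/2} e^{-t/2}`
from the no-fat-half-box hypothesis at `s = 1`, by Hutchcroft's universal tightness
(`prodBernoulli_real_clusterCapIn_ge_le_exp_mul`) and monotonicity in the floor density. -/
theorem stub_dilutionToolkit :
    (∀ s : unitInterval, ∀ z : Site 3, z 0 = 0 →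
      (floorDilutedPercolation 3 (criticalProbI 3) s).map (BondConfig.relabel (sym2Equiv (Site.shift z))) = floorDilutedPercolation 3 (criticalProbI 3) s) ∧
    (∀ C : ℝ, 0 < C →
      (∀ x ∈ insert (0 : Site 3) ({Pi.single 1 1, Pi.single 1 (-1), Pi.single 2 1, Pi.single 2 (-1)} : Finset (Site 3)), ∀ n : ℕ, 1 ≤ n →
        (floorDilutedPercolation 3 (criticalProbI 3) 1).real
          {ω | C * (n : ℝ) ^ ((11 : ℝ) / 4) ≤ (clusterMaxIn (((box 3 n).image fun y : Site 3 => x + y).filter fun z : Site 3 => 0 ≤ z 0) ω : ℝ)}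
            ≤ Real.exp (-1)) →
      ∀ s : unitInterval, ∀ x ∈ insert (0 : Site 3) ({Pi.single 1 1, Pi.single 1 (-1), Pi.single 2 1, Pi.single 2 (-1)} : Finset (Site 3)), ∀ n : ℕ, 1 ≤ n → ∀ t : ℝ, 1 ≤ t →
        (floorDilutedPercolation 3 (criticalProbI 3) s).real
          {ω | t * ((C + 1) * (n : ℝ) ^ ((11 : ℝ) / 4)) ≤ (((↑(box 3 (n)) : Set (Site 3)) ∩ {y : Site 3 | ω ∈ openConnIn {x : Site 3 | 0 ≤ x 0} x (x + y)}).ncard : ℝ)}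
            ≤ Real.exp (3 / 2) * Real.exp (-t / 2)) :=
  ⟨DilutionToolkit.map_shift, fun C hC hfat s x hx n hn t ht =>
    DilutionToolkit.tail C hC hfat s x hx n hn t ht⟩

end Summit.CriticalPhenomena.PercolationContinuityZ3.Theorems.FloorRusso

end
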